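import Summits.ResolutionOfSingularities.ResolutionOfSingularities.Theorems.RadicialJungCleanModelsNSRankOneReductionOfCJS
import Summits.ResolutionOfSingularities.ResolutionOfSingularities.Theorems.RadicialJungCleanModelsDimOfLocalMonomialization
import Summits.ResolutionOfSingularities.ResolutionOfSingularities.Theorems.RadicialJungCleanModelsDimGEFourOfLocalMonomializationRes
import HarnessLib

/-!
# `hMono_4` everywhere ⟸ `hMono_4` at RANK-ONE, NON-(Abhyankar ∧ separable residue field) valuations — mod F-02 + F-32 + Knaf–Kuhlmann (all in kernel)

Route `RadicialJung`, crux `CleanModels` (stmt-ResolutionOfSingularities-15917), registered skeleton `Cruxes/CleanModels/Lines/Sketch.lean`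
rev 35 (sha16 de44649d8f729c3b), stub 7 `stub_cleanModelsDimGEFour`.  Explicit-unit seat `decomp-res-hand-2` g6 (structural hand).  OURS; structural
bookkeeping, counted 0; nothing here proves resolution of singularities in characteristic `p`.

* `localMonomialization_four_of_rankOneRes_of_cjs2020` — ✓ `localMonomialization_four_of_rankOne_of_cjs2020` with its rank-one hypothesis
  further RESTRICTED to valuation rings that are NOT «Abhyankar over `k` with `κ(O)/k` separable»: at those, local uniformization with monomialisation
  from an arbitrary finitely generated start is Knaf–Kuhlmann 2005 Thm. 1.1, DISCHARGED in the tree (✓ `localMonomialization_at_abhyankarPlace`,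
  hand-1 g3's ✓ `KK05ValueBasis.knafKuhlmann2005_Thm11_monomialForm_holds`).
* `cleanModels_dimFour_of_rankOneRes_cjs2020` — the `d = 4` slice of stub 7 from F-02 ∧ F-32 ∧ that restricted rank-one input ∧ `hND_4` ∧ `hZ_4`
  (✓ `cleanModels_dim_of_localMonomialization 3`).  Census node: in dimension `4` the crux is «LU-with-monomialisation at rank-one non-Abhyankar-or-
  inseparable-residue valuations (the (E)LU₄ core) ∧ class (B)₄ ∧ patching₄», modulo print.
[cite: NovacoskiSpivakovsky2014, Thm. 1.2] [cite: KnafKuhlmann2005, Thm. 1.1] [cite: CossartPiltant2019, Thm. 1.1] [cite: CossartJannsenSaito2020, Thm. 1.4]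
-/

noncomputable section

set_option linter.dupNamespace false -- mandated namespace of this single-conjunct summit

open IsLocalRing AlgebraicGeometry CategoryTheory
open Literature.AlgebraicGeometry.Resolution Literature.AlgebraicGeometry.Motives

namespace Summit.ResolutionOfSingularities.ResolutionOfSingularities.Theorems.RadicialJung.CleanModels

/-- **`hMono_4` everywhere from `hMono_4` at rank-one valuations that are not Abhyankar-with-separable-residue-field, modulo F-02 + F-32** (Knaf–Kuhlmann
at the Abhyankar separable ones, ✓ discharged). [cite: NovacoskiSpivakovsky2014, Thm. 1.2] [cite: KnafKuhlmann2005, Thm. 1.1] -/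
theorem localMonomialization_four_of_rankOneRes_of_cjs2020 (hCP : CossartPiltant2019.{0}) (hCJS : CossartJannsenSaito2020Embedded.{0})
    {k K : Type} [Field k] [Field K] [Algebra k K]
    (O : ValuationSubring K)
    (hRankOneRes : ¬ (∃ O₁ : ValuationSubring K, O ≤ O₁ ∧ O₁ ≠ O ∧ O₁ ≠ ⊤) →
      (∀ hk : ∀ c : k, algebraMap k K c ∈ O, ¬ (transcendenceDefect k O hk = 0 ∧
        @Algebra.IsSeparable k (ResidueField O) _ _
          ((IsLocalRing.residue O).comp ((algebraMap k K).codRestrict O hk)).toAlgebra)) →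
      ∀ (A : Subalgebra k K), A.toSubring ≤ O.toSubring → A.FG → IsFractionRing A K →
      ringKrullDim A ≤ (4 : WithBot ℕ∞) →
      ∀ Z : Finset K, (∀ z ∈ Z, z ∈ A) →
      ∃ (A' : Subalgebra k K), A'.toSubring ≤ O.toSubring ∧ A ≤ A' ∧ A'.FG ∧
      ∃ (_ : IsRegularLocalRing (locAtCentre A'.toSubring O)) (e : ℕ) (a : Fin e → ↥(locAtCentre A'.toSubring O)),
        Ideal.span (Set.range a) = IsLocalRing.maximalIdeal ↥(locAtCentre A'.toSubring O) ∧
        ringKrullDim ↥(locAtCentre A'.toSubring O) = (e : WithBot ℕ∞) ∧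
        ∀ z ∈ Z, z ≠ 0 → ∃ (v : ↥(locAtCentre A'.toSubring O)) (μ : Fin e → ℕ), IsUnit v ∧
          z = (v : K) * ∏ i, ((a i : ↥(locAtCentre A'.toSubring O)) : K) ^ (μ i))
    (A : Subalgebra k K) (hAO : A.toSubring ≤ O.toSubring) (hAfg : A.FG) (hfrac : IsFractionRing A K)
    (hdimA : ringKrullDim A ≤ (4 : WithBot ℕ∞)) (Z : Finset K) (hZ : ∀ z ∈ Z, z ∈ A) :
      ∃ (A' : Subalgebra k K), A'.toSubring ≤ O.toSubring ∧ A ≤ A' ∧ A'.FG ∧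
      ∃ (_ : IsRegularLocalRing (locAtCentre A'.toSubring O)) (e : ℕ) (a : Fin e → ↥(locAtCentre A'.toSubring O)),
        Ideal.span (Set.range a) = IsLocalRing.maximalIdeal ↥(locAtCentre A'.toSubring O) ∧
        ringKrullDim ↥(locAtCentre A'.toSubring O) = (e : WithBot ℕ∞) ∧
        ∀ z ∈ Z, z ≠ 0 → ∃ (v : ↥(locAtCentre A'.toSubring O)) (μ : Fin e → ℕ), IsUnit v ∧
          z = (v : K) * ∏ i, ((a i : ↥(locAtCentre A'.toSubring O)) : K) ^ (μ i) := by
  refine localMonomialization_four_of_rankOne_of_cjs2020 hCP hCJS O (fun hR1 A₁ hA₁O hA₁fg hfrac₁ hdimA₁ Z₁ hZ₁ => ?_)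
    A hAO hAfg hfrac hdimA Z hZ
  have hk : ∀ c : k, algebraMap k K c ∈ O := fun c => hA₁O (A₁.algebraMap_mem c)
  by_cases hAbh : transcendenceDefect k O hk = 0 ∧
      @Algebra.IsSeparable k (ResidueField O) _ _ ((IsLocalRing.residue O).comp ((algebraMap k K).codRestrict O hk)).toAlgebra
  · exact localMonomialization_at_abhyankarPlace k K O A₁ hA₁O hA₁fg hfrac₁ hk hAbh.1 hAbh.2 Z₁ hZ₁
  · refine hRankOneRes hR1 (fun hk' => ?_) A₁ hA₁O hA₁fg hfrac₁ hdimA₁ Z₁ hZ₁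
    have : hk' = hk := rfl
    rw [this]
    exact hAbh

/-- **`CleanModels` in dimension `4` from F-02, F-32, rank-one non-(Abhyankar ∧ separable) LU-with-monomialisation, class (B)₄ and patching₄.**
[cite: NovacoskiSpivakovsky2014, Thm. 1.2] [cite: KnafKuhlmann2005, Thm. 1.1] [cite: CossartPiltant2019, Thm. 1.1] [cite: CossartJannsenSaito2020, Thm. 1.4]
[cite: Piltant2013, Cor. 5.7] -/
theorem cleanModels_dimFour_of_rankOneRes_cjs2020 (hCP : CossartPiltant2019.{0}) (hCJS : CossartJannsenSaito2020Embedded.{0})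
    (hMonoRankOneRes : ∀ (k : Type) [Field k] (K : Type) [Field K] [Algebra k K] (O : ValuationSubring K),
      ¬ (∃ O₁ : ValuationSubring K, O ≤ O₁ ∧ O₁ ≠ O ∧ O₁ ≠ ⊤) →
      (∀ hk : ∀ c : k, algebraMap k K c ∈ O, ¬ (transcendenceDefect k O hk = 0 ∧
        @Algebra.IsSeparable k (ResidueField O) _ _
          ((IsLocalRing.residue O).comp ((algebraMap k K).codRestrict O hk)).toAlgebra)) →
      ∀ (A : Subalgebra k K), A.toSubring ≤ O.toSubring → A.FG → IsFractionRing A K →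
      ringKrullDim A ≤ (4 : WithBot ℕ∞) →
      ∀ Z : Finset K, (∀ z ∈ Z, z ∈ A) →
      ∃ (A' : Subalgebra k K), A'.toSubring ≤ O.toSubring ∧ A ≤ A' ∧ A'.FG ∧
      ∃ (_ : IsRegularLocalRing (locAtCentre A'.toSubring O)) (e : ℕ) (a : Fin e → ↥(locAtCentre A'.toSubring O)),
        Ideal.span (Set.range a) = IsLocalRing.maximalIdeal ↥(locAtCentre A'.toSubring O) ∧
        ringKrullDim ↥(locAtCentre A'.toSubring O) = (e : WithBot ℕ∞) ∧
        ∀ z ∈ Z, z ≠ 0 → ∃ (v : ↥(locAtCentre A'.toSubring O)) (μ : Fin e → ℕ), IsUnit v ∧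
          z = (v : K) * ∏ i, ((a i : ↥(locAtCentre A'.toSubring O)) : K) ^ (μ i))
    (hND : ∀ (p : ℕ), p.Prime →
    ∀ (k : Type) [Field k] [CharP k p] (K : Type) [Field K] [Algebra k K]
    (O : ValuationSubring K) (A : Subalgebra k K), A.toSubring ≤ O.toSubring → A.FG → IsFractionRing A K →
    ringKrullDim A ≤ ((3 + 1 : ℕ) : WithBot ℕ∞) → IsRegularLocalRing (locAtCentre A.toSubring O) →
    ringKrullDim (locAtCentre A.toSubring O) = ((3 + 1 : ℕ) : WithBot ℕ∞) →
    (∀ (T : Subring K) (hT : T ≤ O.toSubring), A.toSubring ≤ T → (subringCentre T O hT).IsMaximal) →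
    ∀ g₀ : K, (∀ c : K, c ^ p ≠ g₀) →
    (∀ f₀ : K, ∃ f₁ : K, O.valuation (g₀ - f₁ ^ p) < O.valuation (g₀ - f₀ ^ p)) →
    (∀ hk : ∀ c : k, algebraMap k K c ∈ O, transcendenceDefect k O hk ≠ 0) →
    ¬ (∃ π : K, π ≠ 0 ∧ (∀ x : K, O.valuation x < 1 → O.valuation x ≤ O.valuation π) ∧
      (∀ x : K, x ≠ 0 → ∃ n : ℕ, O.valuation π ^ n ≤ O.valuation x)) →
    ∃ (A' : Subalgebra k K), A'.toSubring ≤ O.toSubring ∧ A ≤ A' ∧ A'.FG ∧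
    ∃ (_ : IsRegularLocalRing (locAtCentre A'.toSubring O)) (c : Fin p → K), (∃ j : Fin p, (j : ℕ) ≠ 0 ∧ c j ≠ 0) ∧
    ((∃ (d m : ℕ) (hmd : m ≤ d) (t : Fin d → ↥(locAtCentre A'.toSubring O)) (a : Fin m → ℕ) (u : ↥(locAtCentre A'.toSubring O)), IsUnit u ∧
    Ideal.span (Set.range t) = IsLocalRing.maximalIdeal ↥(locAtCentre A'.toSubring O) ∧
    ringKrullDim ↥(locAtCentre A'.toSubring O) = (d : WithBot ℕ∞) ∧ 0 < m ∧ (∀ i, ¬ p ∣ a i) ∧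
    (∑ j : Fin p, c j ^ p * g₀ ^ (j : ℕ)) = (u : K) * ∏ i : Fin m, ((t (Fin.castLE hmd i) : ↥(locAtCentre A'.toSubring O)) : K) ^ (a i)) ∨
    (∃ u : ↥(locAtCentre A'.toSubring O), IsUnit u ∧ (∑ j : Fin p, c j ^ p * g₀ ^ (j : ℕ)) = (u : K) ∧
    ∀ c' : ↥(locAtCentre A'.toSubring O), u - c' ^ p ∉ IsLocalRing.maximalIdeal ↥(locAtCentre A'.toSubring O)) ∨
    (∃ s c' : ↥(locAtCentre A'.toSubring O), (∑ j : Fin p, c j ^ p * g₀ ^ (j : ℕ)) = (s : K) ∧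
    s - c' ^ p ∈ IsLocalRing.maximalIdeal ↥(locAtCentre A'.toSubring O) ∧
    s - c' ^ p ∉ IsLocalRing.maximalIdeal ↥(locAtCentre A'.toSubring O) ^ 2)))
    (hZ : ∀ (p : ℕ), p.Prime → ∀ (k K : Type) [Field k] [CharP k p] [Field K] [Algebra k K] [Algebra.EssFiniteType k K],
    Algebra.trdeg k K = (3 + 1 : ℕ) → ∀ (g₀ : K) (M₁ M₂ : ProjModel k K) (U₁ : M₁.X.Opens) (U₂ : M₂.X.Opens),
    (∀ x ∈ U₁, ModelCleanRegAt p g₀ M₁ x) → (∀ x ∈ U₂, ModelCleanRegAt p g₀ M₂ x) →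
    ∃ (N : ProjModel k K) (φ₁ : N.Hom M₁) (φ₂ : N.Hom M₂),
    (∀ y : N.X, φ₁.f y ∈ U₁ → ModelCleanRegAt p g₀ N y) ∧ (∀ y : N.X, φ₂.f y ∈ U₂ → ModelCleanRegAt p g₀ N y)) :
    ∀ p : ℕ, p.Prime → ∀ (k : Type) [Field k] [CharP k p] (W : AlgebraicGeometry.Scheme.{0}) [AlgebraicGeometry.IsIntegral W] (f : W ⟶ AlgebraicGeometry.Spec (.of k)) (L : Type) [Field L] [Algebra W.functionField L], AlgebraicGeometry.IsSeparated f → AlgebraicGeometry.LocallyOfFiniteType f → AlgebraicGeometry.QuasiCompact f → Literature.AlgebraicGeometry.Resolution.Scheme.IsRegular W → IsPurelyInseparable W.functionField L → Module.finrank W.functionField L = p → topologicalKrullDim W = ((3 + 1 : ℕ) : WithBot ℕ∞) → ∃ (V : AlgebraicGeometry.Scheme.{0}) (π : V ⟶ W) (_ : AlgebraicGeometry.IsIntegral V) (_ : AlgebraicGeometry.IsDominant π), AlgebraicGeometry.IsProper π ∧ Literature.AlgebraicGeometry.Resolution.IsBirational π ∧ Literature.AlgebraicGeometry.Resolution.Scheme.IsRegular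 V ∧ (∀ v : V, (∃ (y : L) (g : W.functionField), y ∉ Set.range (algebraMap W.functionField L) ∧ algebraMap W.functionField L g = y ^ p ∧ ((∃ (d m : ℕ) (hmd : m ≤ d) (t : Fin d → V.presheaf.stalk v) (a : Fin m → ℕ), Ideal.span (Set.range t) = IsLocalRing.maximalIdeal (V.presheaf.stalk v) ∧ ringKrullDim (V.presheaf.stalk v) = (d : WithBot ℕ∞) ∧ 0 < m ∧ (∀ i, ¬ p ∣ a i) ∧ Literature.AlgebraicGeometry.Motives.RatFn.functionFieldMap π g = ∏ i : Fin m, (algebraMap (V.presheaf.stalk v) V.functionField (t (Fin.castLE hmd i))) ^ (a i)) ∨ (∃ u₀ : V.presheaf.stalk v, IsUnit u₀ ∧ Literature.AlgebraicGeometry.Motives.RatFn.functionFieldMap π g = algebraMap (V.presheaf.stalk v) V.functionField u₀ ∧ ((∀ c : V.presheaf.stalk v, u₀ - c ^ p ∉ IsLocalRing.maximalIdeal (V.presheaf.stalk v)) ∨ (∃ c : V.presheaf.stalk v, u₀ - c ^ p ∈ IsLocalRing.maximalIdeal (V.presheaf.stalk v) ∧ u₀ - c ^ p ∉ IsLocalRing.maximalIdeal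 (V.presheaf.stalk v) ^ 2)))))) := by
  refine cleanModels_dim_of_localMonomialization 3 ?_ hND hZ
  intro k _ K _ _ O A hAO hAfg hfrac hdimA _ _ _ Z hZ'
  have hdimA' : ringKrullDim A ≤ (4 : WithBot ℕ∞) := hdimA
  exact localMonomialization_four_of_rankOneRes_of_cjs2020 hCP hCJS O (hMonoRankOneRes k K O) A hAO hAfg hfrac hdimA' Z hZ'

/-- **`CleanModels` in dimension `4` — the rank-one input restricted further to ZERO-DIMENSIONAL valuation rings** (witnessed by a finitely generated
model all of whose intermediate subrings have maximal centre, the tree's `hzd`): the graded assembly ✓ `cleanModels_dim_of_localMonomialization 3`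
only ever asks for monomialisation along such `O`, and the witness is passed through.  So the `d = 4` slice of stub 7 follows from F-02 ∧ F-32 ∧
«LU with monomialisation of finitely generated models of trdeg-`≤ 4` function fields along RANK-ONE, ZERO-DIMENSIONAL valuation rings that are NOT
(Abhyankar ∧ separable residue field)» ∧ `hND_4` ∧ `hZ_4` — the honest (E)LU₄ core plus class (B)₄ and patching₄.
[cite: NovacoskiSpivakovsky2014, Thm. 1.2] [cite: KnafKuhlmann2005, Thm. 1.1] [cite: CutkoskyMourtada2019, Def. 1.2] [cite: Piltant2013, Cor. 5.7] -/
theorem cleanModels_dimFour_of_rankOneResZeroDim_cjs2020 (hCP : CossartPiltant2019.{0}) (hCJS : CossartJannsenSaito2020Embedded.{0})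
    (hMonoCore : ∀ (k : Type) [Field k] (K : Type) [Field K] [Algebra k K] (O : ValuationSubring K),
      ¬ (∃ O₁ : ValuationSubring K, O ≤ O₁ ∧ O₁ ≠ O ∧ O₁ ≠ ⊤) →
      (∃ (A₀ : Subalgebra k K), A₀.toSubring ≤ O.toSubring ∧ A₀.FG ∧ IsFractionRing A₀ K ∧
        ∀ (T : Subring K) (hT : T ≤ O.toSubring), A₀.toSubring ≤ T → (subringCentre T O hT).IsMaximal) →
      (∀ hk : ∀ c : k, algebraMap k K c ∈ O, ¬ (transcendenceDefect k O hk = 0 ∧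
        @Algebra.IsSeparable k (ResidueField O) _ _
          ((IsLocalRing.residue O).comp ((algebraMap k K).codRestrict O hk)).toAlgebra)) →
      ∀ (A : Subalgebra k K), A.toSubring ≤ O.toSubring → A.FG → IsFractionRing A K →
      ringKrullDim A ≤ (4 : WithBot ℕ∞) →
      ∀ Z : Finset K, (∀ z ∈ Z, z ∈ A) →
      ∃ (A' : Subalgebra k K), A'.toSubring ≤ O.toSubring ∧ A ≤ A' ∧ A'.FG ∧
      ∃ (_ : IsRegularLocalRing (locAtCentre A'.toSubring O)) (e : ℕ) (a : Fin e → ↥(locAtCentre A'.toSubring O)),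
        Ideal.span (Set.range a) = IsLocalRing.maximalIdeal ↥(locAtCentre A'.toSubring O) ∧
        ringKrullDim ↥(locAtCentre A'.toSubring O) = (e : WithBot ℕ∞) ∧
        ∀ z ∈ Z, z ≠ 0 → ∃ (v : ↥(locAtCentre A'.toSubring O)) (μ : Fin e → ℕ), IsUnit v ∧
          z = (v : K) * ∏ i, ((a i : ↥(locAtCentre A'.toSubring O)) : K) ^ (μ i))
    (hND : ∀ (p : ℕ), p.Prime →
    ∀ (k : Type) [Field k] [CharP k p] (K : Type) [Field K] [Algebra k K]
    (O : ValuationSubring K) (A : Subalgebra k K), A.toSubring ≤ O.toSubring → A.FG → IsFractionRing A K →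
    ringKrullDim A ≤ ((3 + 1 : ℕ) : WithBot ℕ∞) → IsRegularLocalRing (locAtCentre A.toSubring O) →
    ringKrullDim (locAtCentre A.toSubring O) = ((3 + 1 : ℕ) : WithBot ℕ∞) →
    (∀ (T : Subring K) (hT : T ≤ O.toSubring), A.toSubring ≤ T → (subringCentre T O hT).IsMaximal) →
    ∀ g₀ : K, (∀ c : K, c ^ p ≠ g₀) →
    (∀ f₀ : K, ∃ f₁ : K, O.valuation (g₀ - f₁ ^ p) < O.valuation (g₀ - f₀ ^ p)) →
    (∀ hk : ∀ c : k, algebraMap k K c ∈ O, transcendenceDefect k O hk ≠ 0) →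
    ¬ (∃ π : K, π ≠ 0 ∧ (∀ x : K, O.valuation x < 1 → O.valuation x ≤ O.valuation π) ∧
      (∀ x : K, x ≠ 0 → ∃ n : ℕ, O.valuation π ^ n ≤ O.valuation x)) →
    ∃ (A' : Subalgebra k K), A'.toSubring ≤ O.toSubring ∧ A ≤ A' ∧ A'.FG ∧
    ∃ (_ : IsRegularLocalRing (locAtCentre A'.toSubring O)) (c : Fin p → K), (∃ j : Fin p, (j : ℕ) ≠ 0 ∧ c j ≠ 0) ∧
    ((∃ (d m : ℕ) (hmd : m ≤ d) (t : Fin d → ↥(locAtCentre A'.toSubring O)) (a : Fin m → ℕ) (u : ↥(locAtCentre A'.toSubring O)), IsUnit u ∧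
    Ideal.span (Set.range t) = IsLocalRing.maximalIdeal ↥(locAtCentre A'.toSubring O) ∧
    ringKrullDim ↥(locAtCentre A'.toSubring O) = (d : WithBot ℕ∞) ∧ 0 < m ∧ (∀ i, ¬ p ∣ a i) ∧
    (∑ j : Fin p, c j ^ p * g₀ ^ (j : ℕ)) = (u : K) * ∏ i : Fin m, ((t (Fin.castLE hmd i) : ↥(locAtCentre A'.toSubring O)) : K) ^ (a i)) ∨
    (∃ u : ↥(locAtCentre A'.toSubring O), IsUnit u ∧ (∑ j : Fin p, c j ^ p * g₀ ^ (j : ℕ)) = (u : K) ∧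
    ∀ c' : ↥(locAtCentre A'.toSubring O), u - c' ^ p ∉ IsLocalRing.maximalIdeal ↥(locAtCentre A'.toSubring O)) ∨
    (∃ s c' : ↥(locAtCentre A'.toSubring O), (∑ j : Fin p, c j ^ p * g₀ ^ (j : ℕ)) = (s : K) ∧
    s - c' ^ p ∈ IsLocalRing.maximalIdeal ↥(locAtCentre A'.toSubring O) ∧
    s - c' ^ p ∉ IsLocalRing.maximalIdeal ↥(locAtCentre A'.toSubring O) ^ 2)))
    (hZ : ∀ (p : ℕ), p.Prime → ∀ (k K : Type) [Field k] [CharP k p] [Field K] [Algebra k K] [Algebra.EssFiniteType k K],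
    Algebra.trdeg k K = (3 + 1 : ℕ) → ∀ (g₀ : K) (M₁ M₂ : ProjModel k K) (U₁ : M₁.X.Opens) (U₂ : M₂.X.Opens),
    (∀ x ∈ U₁, ModelCleanRegAt p g₀ M₁ x) → (∀ x ∈ U₂, ModelCleanRegAt p g₀ M₂ x) →
    ∃ (N : ProjModel k K) (φ₁ : N.Hom M₁) (φ₂ : N.Hom M₂),
    (∀ y : N.X, φ₁.f y ∈ U₁ → ModelCleanRegAt p g₀ N y) ∧ (∀ y : N.X, φ₂.f y ∈ U₂ → ModelCleanRegAt p g₀ N y)) :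
    ∀ p : ℕ, p.Prime → ∀ (k : Type) [Field k] [CharP k p] (W : AlgebraicGeometry.Scheme.{0}) [AlgebraicGeometry.IsIntegral W] (f : W ⟶ AlgebraicGeometry.Spec (.of k)) (L : Type) [Field L] [Algebra W.functionField L], AlgebraicGeometry.IsSeparated f → AlgebraicGeometry.LocallyOfFiniteType f → AlgebraicGeometry.QuasiCompact f → Literature.AlgebraicGeometry.Resolution.Scheme.IsRegular W → IsPurelyInseparable W.functionField L → Module.finrank W.functionField L = p → topologicalKrullDim W = ((3 + 1 : ℕ) : WithBot ℕ∞) → ∃ (V : AlgebraicGeometry.Scheme.{0}) (π : V ⟶ W) (_ : AlgebraicGeometry.IsIntegral V) (_ : AlgebraicGeometry.IsDominant π), AlgebraicGeometry.IsProper π ∧ Literature.AlgebraicGeometry.Resolution.IsBirational π ∧ Literature.AlgebraicGeometry.Resolution.Scheme.IsRegular V ∧ (∀ v : V, (∃ (y : L) (g : W.functionField), y ∉ Set.range (algebraMap W.functionField L) ∧ algebraMap W.functionField L g = y ^ p ∧ ((∃ (d m : ℕ) (hmd : m ≤ d) (t : Fin d → V.presheaf.stalk v) (a : Fin m → ℕ),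 Ideal.span (Set.range t) = IsLocalRing.maximalIdeal (V.presheaf.stalk v) ∧ ringKrullDim (V.presheaf.stalk v) = (d : WithBot ℕ∞) ∧ 0 < m ∧ (∀ i, ¬ p ∣ a i) ∧ Literature.AlgebraicGeometry.Motives.RatFn.functionFieldMap π g = ∏ i : Fin m, (algebraMap (V.presheaf.stalk v) V.functionField (t (Fin.castLE hmd i))) ^ (a i)) ∨ (∃ u₀ : V.presheaf.stalk v, IsUnit u₀ ∧ Literature.AlgebraicGeometry.Motives.RatFn.functionFieldMap π g = algebraMap (V.presheaf.stalk v) V.functionField u₀ ∧ ((∀ c : V.presheaf.stalk v, u₀ - c ^ p ∉ IsLocalRing.maximalIdeal (V.presheaf.stalk v)) ∨ (∃ c : V.presheaf.stalk v, u₀ - c ^ p ∈ IsLocalRing.maximalIdeal (V.presheaf.stalk v) ∧ u₀ - c ^ p ∉ IsLocalRing.maximalIdeal (V.presheaf.stalk v) ^ 2)))))) := by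
  refine cleanModels_dim_of_localMonomialization 3 ?_ hND hZ
  intro k _ K _ _ O A hAO hAfg hfrac hdimA _ _ hzd Z hZ'
  have hdimA' : ringKrullDim A ≤ (4 : WithBot ℕ∞) := hdimA
  exact localMonomialization_four_of_rankOneRes_of_cjs2020 hCP hCJS O
    (fun hR1 => hMonoCore k K O hR1 ⟨A, hAO, hAfg, hfrac, hzd⟩) A hAO hAfg hfrac hdimA' Z hZ'

end Summit.ResolutionOfSingularities.ResolutionOfSingularities.Theorems.RadicialJung.CleanModels

end
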